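import Literature.Analysis.FluidPDE.JohanssonSorellaAutonomousForce
import Literature.Analysis.FluidPDE.TwoHalfWeakLimits
import Literature.Analysis.FluidPDE.PassiveScalarClassicalEnergy
import Literature.Analysis.FluidPDE.PassiveScalarFluctuationDissipation
import Literature.Analysis.FunctionSpaces.TorusSpaceTime
import HarnessLib

/-!
# Johansson–Sorella 2024, Theorem 1.5: the `2½`-dimensional reduction of §10

Theorem-only support file for the vendored named fact
`Literature.Analysis.FluidPDE.johanssonSorella_autonomousForce_anomalousDissipation`
(`JohanssonSorellaAutonomousForce.lean`; C. J. P. Johansson, M. Sorella, *Anomalous dissipation via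
spontaneous stochasticity with a two-dimensional autonomous velocity field*, arXiv:2409.03599 =
Duke Math. J. (2025), doi:10.1215/00127094-2025-0067, Thm. 1.5, p. 5).

The printed proof of Thm. 1.5 (source, §10, pp. 45–46) is one page long and consists of the
`(2 + ½)`-dimensional trick ("we suppose that all the functions in the system are independent on
the last variable `x₃` … the first two equations decouple with the last one", system (10.1)): with
`ν_q = κ_q`, the *steady* planar velocity `u_{q+2} ∈ C^∞(T²)` of the paper's §7 (formula (7.10)),
the zero-average pressure `p_{q+2}` with `Δp_{q+2} = -div div (u_{q+2} ⊗ u_{q+2})`, the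
time-independent planar force `f_q = L(u_{q+2}·∇u_{q+2}) - ν_q Δu_{q+2} = (u_{q+2}·∇)u_{q+2} + ∇p_{q+2} - ν_qΔu_{q+2}`
and the solution `θ_{κ_q}` of `∂ₜθ + u_{q+2}·∇θ = κ_qΔθ`, `θ(0) = θ_in`, the field
`v_q = (u_{q+2}, θ_{κ_q})`, `P_q = p_{q+2}` solves the forced Navier–Stokes system (1.2) on `T³` with
datum `(u_{q+2}, θ_in)` and force `(f_q, 0)`, and
`ν_q ∫₀¹∫_{T³} |∇v_q|² ≥ κ_q ∫₀¹∫_{T²} |∇θ_{κ_q}|²` (source, §10, display after "Finally").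
Everything else in §10 is INPUT from the body of the paper: the anomalous dissipation of the planar
scalars (Thm. 1.1 via Prop. 4.2, Lemma 2.2 and (9.1)) and the `C^α` convergence of `u_{q+2}` and of
the planar forces (Lemma 7.6, (7.11)–(7.13)).

This file proves exactly that reduction, in the tree's vocabulary, as
`JohanssonSorella2024.exists_autonomousForce_of_planar` (one Hölder exponent) and
`johanssonSorella_autonomousForce_anomalousDissipation_of_planar` (the named fact from its planar
input for every `α ∈ (0,1)`): given vanishing diffusivities `κ_q`, smooth steady divergence-free
planar drifts `u_q → u₀` in `C^{0,α}(T²)`, smooth planar pressures `p_q` whose steady Navier–Stokes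
forces `f_q = (u_q·∇)u_q - κ_qΔu_q + ∇p_q` converge in `C^{0,α}(T²)`, one smooth datum `θ_in`, and
classical solutions `θ_q` of the advection–diffusion equations on `[0,1] × T²` whose dissipation
`κ_q ∫₀¹ ‖∇θ_q‖²` stays `≥ ε`, the `2½`-dimensional fields `(u_q, θ_q(t)) ∘ π` witness
`johanssonSorella_autonomousForce_anomalousDissipation` at `α`. The Navier–Stokes bookkeeping is the
tree's `Torus.isClassicalNSSolutionOn_twoHalf` (`TwoHalfNavierStokes`), the dissipation splitting is
`Torus.gradNormSq_twoHalf`, and the Hölder transfer along `π : T³ → T²` is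
`Torus.eBoundedHolderNorm_twoHalf_zero_right_le` (`TwoHalfWeakLimits`).

What remains for `johanssonSorella_autonomousForce_anomalousDissipation_holds` is therefore exactly
the planar input, i.e. the paper's main Theorem 1.1 in the quantitative form used in §10 (the
branching-pipe velocity fields of §7 with Lemma 7.6 and the spontaneous-stochasticity lower bound
(9.2)–(9.3) of §9); it is not restated here as a named fact (D-0026).
`JohanssonSorella2024.exists_autonomousForce_of_stochasticFlow` pushes the reduction one printed
step further, through the criterion Prop. 4.2 / Lemma 2.8 (the tree's
`Torus.IsClassicalScalarTransportOn.fluctuation_dissipation_of_repr`,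
`PassiveScalarFluctuationDissipation`): the planar anomalous dissipation is replaced by random maps
`X_q : T² → Ω_q → T²` (the backward stochastic flows `X^{q,κ_q}_{1,0}` of Def. 2.6) that preserve
volume pathwise, represent the scalar (`θ_q(1, x) = E[θ_in(X_q x ·)]`, Feynman–Kac, Thm. 2.7) and
have space-integrated variance `∫ Var[θ_in(X_q x ·)] dx ≥ ε` for infinitely many `q` (the
integrated form of (4.1)). No definition and no named fact is introduced: this file contains
theorems only.

## References

* C. J. P. Johansson, M. Sorella, *Anomalous dissipation via spontaneous stochasticity with a
  two-dimensional autonomous velocity field*, arXiv:2409.03599v2 (2024; Duke Math. J. 2025,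
  doi:10.1215/00127094-2025-0067): Thm. 1.5 (p. 5); §10, system (10.1) and the proof of Thm. 1.5
  (pp. 45–46); Thm. 1.1 (p. 2), Prop. 4.2 (pp. 11–12), Lemma 7.6 (p. 27). [`JohanssonSorella2024`]
* A. J. Majda, A. L. Bertozzi, *Vorticity and Incompressible Flow* (CUP 2002), §2.3.1
  (two-and-a-half-dimensional flows).
-/

noncomputable section

open MeasureTheory Set Filter
open _root_.Topology
open scoped ENNReal NNReal InnerProductSpace

namespace Literature.Analysis.FluidPDE

namespace JohanssonSorella2024

open Literature.Analysis.FunctionSpaces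
open Literature.Analysis.FunctionSpaces.Torus (twoHalf planarProj)

/-- The notion of classical Navier–Stokes solution on `S × T³` only depends on the values of the
force on `S × T³` (all terms of the momentum equation are pointwise in `(t, x)`). [folklore] -/
theorem isClassicalNSSolutionOn_congr_force {S : Set ℝ} {ν : ℝ} {f g u : ℝ → T3 → R3}
    {p : ℝ → T3 → ℝ} (h : Torus.IsClassicalNSSolutionOn S ν f u p)
    (hfg : ∀ t ∈ S, ∀ x, f t x = g t x) : Torus.IsClassicalNSSolutionOn S ν g u p where
  smooth_velocity := h.smooth_velocity
  smooth_pressure := h.smooth_pressure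
  momentum t ht x := by
    rw [← hfg t ht x]
    exact h.momentum t ht x
  divFree := h.divFree

/-- **The `2½`-dimensional force of a steady planar flow is steady and horizontal** (source, §10,
system (10.1): for `x₃`-independent fields "the first two equations decouple with the last one").
For a time-independent planar velocity `u`, a time-independent planar pressure potential `p` and a
classical solution `θ` on `S` of the advection–diffusion equation `∂ₜθ + u·∇θ = νΔθ`, the
Navier–Stokes force `Torus.twoHalfForce S ν u θ p` of the ansatz `((u, θ(t)) ∘ π, p ∘ π)` equals,
at every `t ∈ S`, the horizontal lift of the steady planar Navier–Stokes force
`(u·∇)u - νΔu + ∇p`: the planar time derivative vanishes and the vertical component is the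
advection–diffusion residual `∂ₜθ + u·∇θ - νΔθ = 0`. [cite: JohanssonSorella2024, §10 (10.1), p. 45] -/
theorem twoHalfForce_steady_eq {S : Set ℝ} {ν : ℝ} {u : UnitAddTorus (Fin 2) → EuclideanSpace ℝ (Fin 2)}
    {p : UnitAddTorus (Fin 2) → ℝ} {θ : ℝ → UnitAddTorus (Fin 2) → ℝ}
    (hθ : Torus.IsClassicalScalarTransportOn S ν (fun _ => u) θ) {t : ℝ} (ht : t ∈ S) (x : T3) :
    Torus.twoHalfForce S ν (fun _ => u) θ (fun _ => p) t x =
      twoHalf (Torus.convect u u - ν • Torus.laplacian u + Torus.gradient p) 0 x := by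
  rw [Torus.twoHalfForce_apply]
  congr 1
  · funext y
    have h0 : Torus.timeDerivWithin S (fun _ : ℝ => u) t y = 0 := by
      simp [Torus.timeDerivWithin]
    rw [h0, zero_add]
    simp only [Pi.add_apply, Pi.sub_apply, Pi.smul_apply]
  · funext y
    have h := hθ.transport t ht y
    rw [Pi.zero_apply, sub_eq_zero]
    simpa using h

/-- **Passing to a subsequence** (the step "(ii) is printed in `limsup` form; pass to a
subsequence realising the `limsup`, then to a strictly decreasing one" recorded in the docstring
of `johanssonSorella_autonomousForce_anomalousDissipation`). If `κ_q > 0`, `κ_q → 0` and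
`ε ≤ D_q` for infinitely many `q`, there is a strictly increasing `φ : ℕ → ℕ` along which `κ` is a
vanishing-viscosity sequence (`IsVanishingViscosity (κ ∘ φ)`: strictly decreasing, positive,
tending to `0`) and `ε ≤ D_{φ n}` for every `n` (recursive choice: given `φ n`, pick a good index
`q > φ n` with `κ_q < κ_{φ n}`, which exists because `κ → 0 < κ_{φ n}`). [folklore] -/
theorem exists_strictMono_isVanishingViscosity {κ D : ℕ → ℝ} (hpos : ∀ q, 0 < κ q)
    (h0 : Tendsto κ atTop (𝓝 0)) {ε : ℝ} (hfreq : ∃ᶠ q in atTop, ε ≤ D q) :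
    ∃ φ : ℕ → ℕ, StrictMono φ ∧ IsVanishingViscosity (κ ∘ φ) ∧ ∀ n, ε ≤ D (φ n) := by
  have step : ∀ (N : ℕ) (c : ℝ), 0 < c → ∃ q, N < q ∧ ε ≤ D q ∧ κ q < c := fun N c hc => by
    have hev : ∀ᶠ q in atTop, κ q < c ∧ N < q :=
      (h0.eventually (gt_mem_nhds hc)).and (eventually_gt_atTop N)
    obtain ⟨q, hq1, hq2, hq3⟩ := (hfreq.and_eventually hev).exists
    exact ⟨q, hq3, hq1, hq2⟩
  choose g hg using step
  let q₀ : ℕ := g 0 1 one_pos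
  have hq₀ : ε ≤ D q₀ := (hg 0 1 one_pos).2.1
  let ψ : ℕ → ℕ := fun n => Nat.rec q₀ (fun _ ih => g ih (κ ih) (hpos ih)) n
  have hψ0 : ψ 0 = q₀ := rfl
  have hψs : ∀ n, ψ (n + 1) = g (ψ n) (κ (ψ n)) (hpos (ψ n)) := fun n => rfl
  have hlt : ∀ n, ψ n < ψ (n + 1) := fun n => by
    rw [hψs n]
    exact (hg (ψ n) (κ (ψ n)) (hpos (ψ n))).1
  have hD : ∀ n, ε ≤ D (ψ n) := fun n => by
    cases n with
    | zero => rw [hψ0]; exact hq₀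
    | succ n => rw [hψs n]; exact (hg (ψ n) (κ (ψ n)) (hpos (ψ n))).2.1
  have hκ : ∀ n, κ (ψ (n + 1)) < κ (ψ n) := fun n => by
    rw [hψs n]
    exact (hg (ψ n) (κ (ψ n)) (hpos (ψ n))).2.2
  have hmono : StrictMono ψ := strictMono_nat_of_lt_succ hlt
  refine ⟨ψ, hmono, ⟨strictAnti_nat_of_succ_lt hκ, h0.comp hmono.tendsto_atTop,
    fun n => hpos (ψ n)⟩, hD⟩

/-- **Johansson–Sorella, Thm. 1.5 from its planar input, one Hölder exponent** (source, §10,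
proof of Thm. 1.5, pp. 45–46). Let `α < 1`. Suppose given: vanishing diffusivities `κ_q`
(`IsVanishingViscosity`); smooth, divergence-free, time-independent planar velocities `u_q` on `T²`
converging in `C^{0,α}` to `u₀ ∈ C^{0,α}`; smooth planar pressures `p_q` such that the steady
planar Navier–Stokes forces `f_q = (u_q·∇)u_q - κ_qΔu_q + ∇p_q` converge in `C^{0,α}` to
`f₀ ∈ C^{0,α}` (in the source: `u_q ↝ u_{q+2}` of (7.10), `p_q ↝ p_{q+2}`,
`f_q = L(u_{q+2}·∇u_{q+2}) - ν_qΔu_{q+2}`, convergence by Lemma 7.6); one smooth datum `θ_in`;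
and classical solutions `θ_q` on `[0,1] × T²` of `∂ₜθ + u_q·∇θ = κ_qΔθ`, `θ_q(0) = θ_in`, whose
dissipation is anomalous, `κ_q ∫₀¹ ‖∇θ_q‖²_{L²(T²)} ≥ ε > 0` eventually (in the source: Thm. 1.1
through Prop. 4.2, Lemma 2.2 and (9.1)). Then the viscosities `ν_q = κ_q`, the time-independent
forces `F_q = (f_q, 0) ∘ π ∈ C^∞(T³)`, the data `v_{in,q} = (u_q, θ_in) ∘ π`, the classical
solutions `v_q(t) = (u_q, θ_q(t)) ∘ π`, `P_q = p_q ∘ π` of forced Navier–Stokes on `[0,1] × T³`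
(`Torus.isClassicalNSSolutionOn_twoHalf` with `twoHalfForce_steady_eq`), and the limits
`F₀ = (f₀, 0) ∘ π`, `v_in = (u₀, θ_in) ∘ π` satisfy clauses (i)–(ii) of Thm. 1.5 as recorded in
`johanssonSorella_autonomousForce_anomalousDissipation` at `α`:
`‖F_q - F₀‖_{C^{0,α}} + ‖v_{in,q} - v_in‖_{C^{0,α}} ≤ ‖f_q - f₀‖_{C^{0,α}} + ‖u_q - u₀‖_{C^{0,α}} → 0`
(`Torus.eBoundedHolderNorm_twoHalf_zero_right_le`) and
`ν_q ∫₀¹ ‖∇v_q‖² = ν_q ∫₀¹ (‖∇u_q‖² + ‖∇θ_q‖²) ≥ κ_q ∫₀¹ ‖∇θ_q‖² ≥ ε`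
(`Torus.gradNormSq_twoHalf`; source, §10, the display after "Finally"). [cite: JohanssonSorella2024, §10, proof of Thm. 1.5, pp. 45–46] -/
theorem exists_autonomousForce_of_planar {α : ℝ≥0} (hα1 : α < 1)
    {κ : ℕ → ℝ} {u : ℕ → UnitAddTorus (Fin 2) → EuclideanSpace ℝ (Fin 2)} {p : ℕ → UnitAddTorus (Fin 2) → ℝ}
    {f : ℕ → UnitAddTorus (Fin 2) → EuclideanSpace ℝ (Fin 2)} {θin : UnitAddTorus (Fin 2) → ℝ}
    {θ : ℕ → ℝ → UnitAddTorus (Fin 2) → ℝ} {u₀ f₀ : UnitAddTorus (Fin 2) → EuclideanSpace ℝ (Fin 2)}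
    (hκ : IsVanishingViscosity κ) (hu : ∀ q, Torus.IsSmooth (u q))
    (hdiv : ∀ q, Torus.IsDivFree (u q)) (hp : ∀ q, Torus.IsSmooth (p q))
    (hf : ∀ q y, f q y =
      Torus.convect (u q) (u q) y - κ q • Torus.laplacian (u q) y + Torus.gradient (p q) y)
    (hθin : Torus.IsSmooth θin)
    (hθ : ∀ q, Torus.IsClassicalScalarTransportOn (Icc 0 1) (κ q) (fun _ => u q) (θ q))
    (hθ0 : ∀ q, θ q 0 = θin)
    (hu₀ : MemBoundedHolder α u₀) (hf₀ : MemBoundedHolder α f₀)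
    (hcu : Tendsto (fun q => eBoundedHolderNorm α (u q - u₀)) atTop (𝓝 0))
    (hcf : Tendsto (fun q => eBoundedHolderNorm α (f q - f₀)) atTop (𝓝 0))
    (hdiss : ∃ ε : ℝ, 0 < ε ∧ ∀ᶠ q in atTop, ε ≤ Torus.scalarDissipation (κ q) (θ q) 0 1) :
    ∃ (ν : ℕ → ℝ) (F vin : ℕ → T3 → R3) (v : ℕ → ℝ → T3 → R3) (P : ℕ → ℝ → T3 → ℝ)
      (F₀ vin₀ : T3 → R3),
      IsVanishingViscosity ν ∧
      (∀ q, Torus.IsSmooth (F q)) ∧ (∀ q, Torus.IsSmooth (vin q)) ∧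
      (∀ q, Torus.IsClassicalNSSolutionOn (Icc 0 1) (ν q) (fun _ => F q) (v q) (P q) ∧
        v q 0 = vin q) ∧
      MemBoundedHolder α F₀ ∧ MemBoundedHolder α vin₀ ∧
      Tendsto (fun q => eBoundedHolderNorm α (F q - F₀) + eBoundedHolderNorm α (vin q - vin₀))
        atTop (𝓝 0) ∧
      HasAnomalousDissipation ν v := by
  have h01 : (0 : ℝ) ∈ Icc (0 : ℝ) 1 := ⟨le_rfl, zero_le_one⟩
  have h11 : (1 : ℝ) ∈ Icc (0 : ℝ) 1 := ⟨zero_le_one, le_rfl⟩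
  have hS : UniqueDiffOn ℝ (Icc (0 : ℝ) 1) := uniqueDiffOn_Icc zero_lt_one
  -- the steady planar forces are smooth
  have hf_eq : ∀ q, f q =
      Torus.convect (u q) (u q) - κ q • Torus.laplacian (u q) + Torus.gradient (p q) := fun q => by
    funext y
    rw [hf q y]
    simp only [Pi.add_apply, Pi.sub_apply, Pi.smul_apply]
  have hf_smooth : ∀ q, Torus.IsSmooth (f q) := fun q => by
    rw [hf_eq q]
    exact (((hu q).convect (hu q)).sub (((hu q).laplacian).smul (κ q))).add (hp q).gradient
  have hzero : Torus.IsSmooth (0 : UnitAddTorus (Fin 2) → ℝ) := Torus.isSmooth_const (0 : ℝ)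
  have hzeroV : Torus.IsSmooth (0 : UnitAddTorus (Fin 2) → EuclideanSpace ℝ (Fin 2)) :=
    Torus.isSmooth_const (0 : EuclideanSpace ℝ (Fin 2))
  refine ⟨κ, fun q => twoHalf (f q) 0, fun q => twoHalf (u q) θin,
    fun q t => twoHalf (u q) (θ q t), fun q _ => p q ∘ planarProj, twoHalf f₀ 0, twoHalf u₀ θin,
    hκ, fun q => (hf_smooth q).twoHalf hzero, fun q => (hu q).twoHalf hθin, fun q => ⟨?_, ?_⟩,
    ?_, ?_, ?_, ?_⟩
  · -- the Navier–Stokes system on `[0,1] × T³` (source, (10.1))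
    have hNS := Torus.isClassicalNSSolutionOn_twoHalf hS (κ q) (V := fun _ => u q) (R := θ q)
      (φ := fun _ => p q) (Torus.isSmoothSpaceTimeOn_const (hu q) _) (hθ q).smooth_scalar
      (Torus.isSmoothSpaceTimeOn_const (hp q) _) (fun t _ => hdiv q)
    refine isClassicalNSSolutionOn_congr_force hNS fun t ht x => ?_
    rw [twoHalfForce_steady_eq (hθ q) ht x, ← hf_eq q]
  · -- the initial datum
    show twoHalf (u q) (θ q 0) = twoHalf (u q) θin
    rw [hθ0 q]
  · -- `F₀ ∈ C^{0,α}(T³)`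
    exact lt_of_le_of_lt (Torus.eBoundedHolderNorm_twoHalf_zero_right_le α f₀) hf₀
  · -- `v_in ∈ C^{0,α}(T³)`
    obtain ⟨B, hB⟩ := (Torus.isSmoothSpaceTimeOn_const (hzeroV.twoHalf hθin)
      (Icc (0 : ℝ) 1)).exists_forall_eBoundedHolderNorm_le isCompact_Icc hS hα1.le
    have hB0 := hB 0 h01
    show eBoundedHolderNorm α (twoHalf u₀ θin) < ∞
    rw [Torus.twoHalf_eq_add u₀ θin]
    calc eBoundedHolderNorm α (twoHalf u₀ 0 + twoHalf 0 θin)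
        ≤ eBoundedHolderNorm α (twoHalf u₀ 0) + eBoundedHolderNorm α (twoHalf 0 θin) :=
          eBoundedHolderNorm_add_le _ _
      _ < ∞ := ENNReal.add_lt_top.2
          ⟨lt_of_le_of_lt (Torus.eBoundedHolderNorm_twoHalf_zero_right_le α u₀) hu₀,
            lt_of_le_of_lt hB0 ENNReal.coe_lt_top⟩
  · -- convergence of forces and data in `C^{0,α}(T³)` (source, Lemma 7.6 ⇒ (i))
    have h1 : ∀ q, eBoundedHolderNorm α (twoHalf (f q) 0 - twoHalf f₀ 0) ≤
        eBoundedHolderNorm α (f q - f₀) := fun q => by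
      rw [← Torus.twoHalf_sub, sub_zero]
      exact Torus.eBoundedHolderNorm_twoHalf_zero_right_le α _
    have h2 : ∀ q, eBoundedHolderNorm α (twoHalf (u q) θin - twoHalf u₀ θin) ≤
        eBoundedHolderNorm α (u q - u₀) := fun q => by
      rw [← Torus.twoHalf_sub, sub_self]
      exact Torus.eBoundedHolderNorm_twoHalf_zero_right_le α _
    have hsum : Tendsto (fun q => eBoundedHolderNorm α (f q - f₀) + eBoundedHolderNorm α (u q - u₀))
        atTop (𝓝 0) := by
      simpa using hcf.add hcu
    exact tendsto_of_tendsto_of_tendsto_of_le_of_le tendsto_const_nhds hsum (fun q => zero_le)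
      fun q => add_le_add (h1 q) (h2 q)
  · -- anomalous dissipation:
    -- `ν_q ∫₀¹ ‖∇v_q‖² = ν_q ∫₀¹ (‖∇u_q‖² + ‖∇θ_q‖²) ≥ κ_q ∫₀¹ ‖∇θ_q‖² ≥ ε`
    obtain ⟨ε, hε, hev⟩ := hdiss
    refine ⟨ε, hε, ?_⟩
    filter_upwards [hev] with q hq
    have hcθ : ContinuousOn (fun s => Torus.scalarGradNormSq (θ q s)) (Icc 0 1) :=
      (hθ q).continuousOn_scalarGradNormSq (convex_Icc 0 1) hS
    have hiθ : IntervalIntegrable (fun s => Torus.scalarGradNormSq (θ q s)) volume 0 1 :=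
      (hcθ.mono (uIcc_subset_Icc h01 h11)).intervalIntegrable
    have hiu : IntervalIntegrable (fun _ : ℝ => Torus.gradNormSq (u q)) volume 0 1 :=
      intervalIntegrable_const
    have hsplit : Torus.cumulativeDissipation (κ q) (fun t => twoHalf (u q) (θ q t)) 0 1 =
        (κ q * ∫ _ in (0 : ℝ)..1, Torus.gradNormSq (u q)) +
          κ q * ∫ s in (0 : ℝ)..1, Torus.scalarGradNormSq (θ q s) := by
      unfold Torus.cumulativeDissipation
      rw [← mul_add, ← intervalIntegral.integral_add hiu hiθ]
      congr 1
      refine intervalIntegral.integral_congr fun s hs => ?_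
      exact Torus.gradNormSq_twoHalf (hu q)
        ((hθ q).smooth_scalar.isSmooth_slice ((uIcc_subset_Icc h01 h11) hs))
    show ε ≤ Torus.cumulativeDissipation (κ q) (fun t => twoHalf (u q) (θ q t)) 0 1
    rw [hsplit]
    have h0 : 0 ≤ κ q * ∫ _ in (0 : ℝ)..1, Torus.gradNormSq (u q) :=
      mul_nonneg (hκ.2.2 q).le
        (intervalIntegral.integral_nonneg zero_le_one fun s _ => Torus.gradNormSq_nonneg _)
    have hdef : Torus.scalarDissipation (κ q) (θ q) 0 1 =
        κ q * ∫ s in (0 : ℝ)..1, Torus.scalarGradNormSq (θ q s) := rfl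
    linarith

/-- **Johansson–Sorella, Thm. 1.5 from its planar input, printed (`limsup`) form of the
dissipation clause.** As `exists_autonomousForce_of_planar`, but with the planar anomalous
dissipation in the form printed in the source ((AD), p. 2, and §10: `limsup_{κ_q → 0} κ_q ∫₀¹∫ |∇θ_{κ_q}|² > 0`),
i.e. diffusivities `κ_q > 0`, `κ_q → 0` (not necessarily monotone) and `ε ≤ κ_q ∫₀¹ ‖∇θ_q‖²`
for infinitely many `q`; one first passes to the subsequence of
`exists_strictMono_isVanishingViscosity`, along which all the other (pointwise in `q` or
convergence) hypotheses persist. [cite: JohanssonSorella2024, §10, proof of Thm. 1.5, pp. 45–46] -/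
theorem exists_autonomousForce_of_planar_frequently {α : ℝ≥0} (hα1 : α < 1)
    {κ : ℕ → ℝ} {u : ℕ → UnitAddTorus (Fin 2) → EuclideanSpace ℝ (Fin 2)} {p : ℕ → UnitAddTorus (Fin 2) → ℝ}
    {f : ℕ → UnitAddTorus (Fin 2) → EuclideanSpace ℝ (Fin 2)} {θin : UnitAddTorus (Fin 2) → ℝ}
    {θ : ℕ → ℝ → UnitAddTorus (Fin 2) → ℝ} {u₀ f₀ : UnitAddTorus (Fin 2) → EuclideanSpace ℝ (Fin 2)}
    (hκpos : ∀ q, 0 < κ q) (hκ0 : Tendsto κ atTop (𝓝 0)) (hu : ∀ q, Torus.IsSmooth (u q))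
    (hdiv : ∀ q, Torus.IsDivFree (u q)) (hp : ∀ q, Torus.IsSmooth (p q))
    (hf : ∀ q y, f q y =
      Torus.convect (u q) (u q) y - κ q • Torus.laplacian (u q) y + Torus.gradient (p q) y)
    (hθin : Torus.IsSmooth θin)
    (hθ : ∀ q, Torus.IsClassicalScalarTransportOn (Icc 0 1) (κ q) (fun _ => u q) (θ q))
    (hθ0 : ∀ q, θ q 0 = θin)
    (hu₀ : MemBoundedHolder α u₀) (hf₀ : MemBoundedHolder α f₀)
    (hcu : Tendsto (fun q => eBoundedHolderNorm α (u q - u₀)) atTop (𝓝 0))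
    (hcf : Tendsto (fun q => eBoundedHolderNorm α (f q - f₀)) atTop (𝓝 0))
    (hdiss : ∃ ε : ℝ, 0 < ε ∧ ∃ᶠ q in atTop, ε ≤ Torus.scalarDissipation (κ q) (θ q) 0 1) :
    ∃ (ν : ℕ → ℝ) (F vin : ℕ → T3 → R3) (v : ℕ → ℝ → T3 → R3) (P : ℕ → ℝ → T3 → ℝ)
      (F₀ vin₀ : T3 → R3),
      IsVanishingViscosity ν ∧
      (∀ q, Torus.IsSmooth (F q)) ∧ (∀ q, Torus.IsSmooth (vin q)) ∧
      (∀ q, Torus.IsClassicalNSSolutionOn (Icc 0 1) (ν q) (fun _ => F q) (v q) (P q) ∧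
        v q 0 = vin q) ∧
      MemBoundedHolder α F₀ ∧ MemBoundedHolder α vin₀ ∧
      Tendsto (fun q => eBoundedHolderNorm α (F q - F₀) + eBoundedHolderNorm α (vin q - vin₀))
        atTop (𝓝 0) ∧
      HasAnomalousDissipation ν v := by
  obtain ⟨ε, hε, hfreq⟩ := hdiss
  obtain ⟨φ, hφ, hvisc, hD⟩ := exists_strictMono_isVanishingViscosity hκpos hκ0 hfreq
  have ht := hφ.tendsto_atTop
  exact exists_autonomousForce_of_planar hα1 (κ := κ ∘ φ) (u := u ∘ φ) (p := p ∘ φ) (f := f ∘ φ)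
    (θ := θ ∘ φ) hvisc (fun q => hu (φ q)) (fun q => hdiv (φ q)) (fun q => hp (φ q))
    (fun q y => hf (φ q) y) hθin (fun q => hθ (φ q)) (fun q => hθ0 (φ q)) hu₀ hf₀ (hcu.comp ht)
    (hcf.comp ht) ⟨ε, hε, Eventually.of_forall hD⟩

/-- **Johansson–Sorella, Thm. 1.5 from its planar input** (source, §10). The named fact
`johanssonSorella_autonomousForce_anomalousDissipation` (forced Navier–Stokes on `T³` with
time-independent, viscosity-dependent smooth forces: `C^{0,α}`-convergent forces and data and
anomalous dissipation, for every `α ∈ (0,1)`) follows from its two-dimensional input, for every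
`α ∈ (0,1)`: vanishing diffusivities `κ_q`; smooth, divergence-free, steady planar drifts
`u_q → u₀` in `C^{0,α}(T²)`; smooth planar pressures `p_q` with steady Navier–Stokes forces
`f_q = (u_q·∇)u_q - κ_qΔu_q + ∇p_q → f₀` in `C^{0,α}(T²)`; a smooth datum `θ_in`; classical
solutions `θ_q` of `∂ₜθ + u_q·∇θ = κ_qΔθ`, `θ_q(0) = θ_in` on `[0,1] × T²` with
`κ_q > 0`, `κ_q → 0` and `κ_q ∫₀¹ ‖∇θ_q‖² ≥ ε > 0` for infinitely many `q` (the printed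
`limsup > 0` form of (AD); the subsequence passage is `exists_strictMono_isVanishingViscosity`).
In the source these are `κ_q` of (6.6), `u_{q+2}` of (7.10)
with Lemma 7.6, the Leray pressure `p_{q+2}`, `θ_in` of Prop. 4.2 and the anomalous dissipation
of Thm. 1.1 (via Prop. 4.2, Lemma 2.2, (9.1)); what remains for
`johanssonSorella_autonomousForce_anomalousDissipation_holds` is exactly this planar input
(the paper's Thm. 1.1 in the quantitative form of §§7–9). [cite: JohanssonSorella2024, §10, proof of Thm. 1.5, pp. 45–46] -/
theorem _root_.Literature.Analysis.FluidPDE.johanssonSorella_autonomousForce_anomalousDissipation_of_planar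
    (H : ∀ α : ℝ≥0, 0 < α → α < 1 →
      ∃ (κ : ℕ → ℝ) (u : ℕ → UnitAddTorus (Fin 2) → EuclideanSpace ℝ (Fin 2)) (p : ℕ → UnitAddTorus (Fin 2) → ℝ)
        (f : ℕ → UnitAddTorus (Fin 2) → EuclideanSpace ℝ (Fin 2)) (θin : UnitAddTorus (Fin 2) → ℝ)
        (θ : ℕ → ℝ → UnitAddTorus (Fin 2) → ℝ) (u₀ f₀ : UnitAddTorus (Fin 2) → EuclideanSpace ℝ (Fin 2)),
        (∀ q, 0 < κ q) ∧ Tendsto κ atTop (𝓝 0) ∧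
        (∀ q, Torus.IsSmooth (u q)) ∧ (∀ q, Torus.IsDivFree (u q)) ∧
        (∀ q, Torus.IsSmooth (p q)) ∧
        (∀ q y, f q y =
          Torus.convect (u q) (u q) y - κ q • Torus.laplacian (u q) y + Torus.gradient (p q) y) ∧
        Torus.IsSmooth θin ∧
        (∀ q, Torus.IsClassicalScalarTransportOn (Icc 0 1) (κ q) (fun _ => u q) (θ q) ∧
          θ q 0 = θin) ∧
        MemBoundedHolder α u₀ ∧ MemBoundedHolder α f₀ ∧
        Tendsto (fun q => eBoundedHolderNorm α (u q - u₀)) atTop (𝓝 0) ∧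
        Tendsto (fun q => eBoundedHolderNorm α (f q - f₀)) atTop (𝓝 0) ∧
        ∃ ε : ℝ, 0 < ε ∧ ∃ᶠ q in atTop, ε ≤ Torus.scalarDissipation (κ q) (θ q) 0 1) :
    johanssonSorella_autonomousForce_anomalousDissipation := by
  intro α hα hα1
  obtain ⟨κ, u, p, f, θin, θ, u₀, f₀, hκpos, hκ0, hu, hdiv, hp, hf, hθin, hθ, hu₀, hf₀, hcu, hcf,
    hdiss⟩ := H α hα hα1
  exact exists_autonomousForce_of_planar_frequently hα1 hκpos hκ0 hu hdiv hp hf hθin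
    (fun q => (hθ q).1) (fun q => (hθ q).2) hu₀ hf₀ hcu hcf hdiss

/-- **Johansson–Sorella, Thm. 1.5 from stochastic Lagrangian data** (source, §10 with Prop. 4.2
and Lemma 2.8). As `exists_autonomousForce_of_planar_frequently`, but with the planar anomalous
dissipation supplied through the fluctuation–dissipation identity: for every `q` a probability
space `(Ω_q, P_q)` and a jointly measurable random map `X_q : T² → Ω_q → T²` such that
`x ↦ X_q x ω` preserves volume for every `ω` (Def. 2.6: the backward stochastic flow of the
divergence-free drift `u_q` with noise `√(2κ_q) dW` on `[0, 1]`, measure preserving pathwise),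
`θ_q(1, x) = E[θ_in(X_q x ·)]` (the Feynman–Kac formula, Thm. 2.7) and
`ε ≤ ∫_{T²} E[|θ_in(X_q x ·) - E[θ_in(X_q x ·)]|²] dx` for infinitely many `q` (the space-integrated
form of the variance bound (4.1) on the dissipative sets `D_q`, `|D_q| ≥ c`, for the datum `θ_in`
of the proof of Prop. 4.2). Indeed `2κ_q ∫₀¹ ‖∇θ_q‖² = ∫ Var[θ_in(X_q x ·)] dx ≥ ε` by (FL-DISS)
(`Torus.IsClassicalScalarTransportOn.fluctuation_dissipation_of_repr`). What then remains of the
source for `johanssonSorella_autonomousForce_anomalousDissipation_holds` is: the stochastic flows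
with these two properties (§2.2), the velocity fields `u_{q+2}` of §7 with Lemma 7.6, and the
variance lower bound of §§8–9. [cite: JohanssonSorella2024, §10 with Prop. 4.2 and Lemma 2.8] -/
theorem exists_autonomousForce_of_stochasticFlow {α : ℝ≥0} (hα1 : α < 1)
    {κ : ℕ → ℝ} {u : ℕ → UnitAddTorus (Fin 2) → EuclideanSpace ℝ (Fin 2)} {p : ℕ → UnitAddTorus (Fin 2) → ℝ}
    {f : ℕ → UnitAddTorus (Fin 2) → EuclideanSpace ℝ (Fin 2)} {θin : UnitAddTorus (Fin 2) → ℝ}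
    {θ : ℕ → ℝ → UnitAddTorus (Fin 2) → ℝ} {u₀ f₀ : UnitAddTorus (Fin 2) → EuclideanSpace ℝ (Fin 2)}
    (hκpos : ∀ q, 0 < κ q) (hκ0 : Tendsto κ atTop (𝓝 0)) (hu : ∀ q, Torus.IsSmooth (u q))
    (hdiv : ∀ q, Torus.IsDivFree (u q)) (hp : ∀ q, Torus.IsSmooth (p q))
    (hf : ∀ q y, f q y =
      Torus.convect (u q) (u q) y - κ q • Torus.laplacian (u q) y + Torus.gradient (p q) y)
    (hθin : Torus.IsSmooth θin)
    (hθ : ∀ q, Torus.IsClassicalScalarTransportOn (Icc 0 1) (κ q) (fun _ => u q) (θ q))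
    (hθ0 : ∀ q, θ q 0 = θin)
    (hu₀ : MemBoundedHolder α u₀) (hf₀ : MemBoundedHolder α f₀)
    (hcu : Tendsto (fun q => eBoundedHolderNorm α (u q - u₀)) atTop (𝓝 0))
    (hcf : Tendsto (fun q => eBoundedHolderNorm α (f q - f₀)) atTop (𝓝 0))
    {Ω : ℕ → Type*} [∀ q, MeasurableSpace (Ω q)] {μ : ∀ q, Measure (Ω q)}
    [∀ q, IsProbabilityMeasure (μ q)] {X : ∀ q, UnitAddTorus (Fin 2) → Ω q → UnitAddTorus (Fin 2)}
    (hX : ∀ q, Measurable (Function.uncurry (X q)))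
    (hmp : ∀ q ω, MeasurePreserving (fun x => X q x ω) volume volume)
    (hrepr : ∀ q x, θ q 1 x = ∫ ω, θin (X q x ω) ∂(μ q))
    (hvar : ∃ ε : ℝ, 0 < ε ∧ ∃ᶠ q in atTop,
      ε ≤ ∫ x, ∫ ω, (θin (X q x ω) - ∫ ω', θin (X q x ω') ∂(μ q)) ^ 2 ∂(μ q)) :
    ∃ (ν : ℕ → ℝ) (F vin : ℕ → T3 → R3) (v : ℕ → ℝ → T3 → R3) (P : ℕ → ℝ → T3 → ℝ)
      (F₀ vin₀ : T3 → R3),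
      IsVanishingViscosity ν ∧
      (∀ q, Torus.IsSmooth (F q)) ∧ (∀ q, Torus.IsSmooth (vin q)) ∧
      (∀ q, Torus.IsClassicalNSSolutionOn (Icc 0 1) (ν q) (fun _ => F q) (v q) (P q) ∧
        v q 0 = vin q) ∧
      MemBoundedHolder α F₀ ∧ MemBoundedHolder α vin₀ ∧
      Tendsto (fun q => eBoundedHolderNorm α (F q - F₀) + eBoundedHolderNorm α (vin q - vin₀))
        atTop (𝓝 0) ∧
      HasAnomalousDissipation ν v := by
  obtain ⟨ε, hε, hfreq⟩ := hvar
  have hFD : ∀ q, ∫ x, ∫ ω, (θin (X q x ω) - ∫ ω', θin (X q x ω') ∂(μ q)) ^ 2 ∂(μ q) =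
      2 * Torus.scalarDissipation (κ q) (θ q) 0 1 := fun q => by
    have h := (hθ q).fluctuation_dissipation_of_repr (P := μ q) zero_le_one subset_rfl (hX q) (hmp q)
      (fun x => by rw [hθ0 q]; exact hrepr q x)
    simpa only [hθ0 q] using h
  refine exists_autonomousForce_of_planar_frequently hα1 hκpos hκ0 hu hdiv hp hf hθin hθ hθ0 hu₀ hf₀
    hcu hcf ⟨ε / 2, half_pos hε, hfreq.mono fun q hq => ?_⟩
  have h := hFD q
  linarith

end JohanssonSorella2024

end Literature.Analysis.FluidPDE

end
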